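import Literature.Analysis.FluidPDE.PassiveVector
import Literature.Analysis.FluidPDE.PassiveScalarFourier
import Literature.Analysis.FunctionSpaces.TorusWeakFormBookkeeping
import Literature.Analysis.FunctionSpaces.TorusFourierConvolution
import HarnessLib

/-!
# The solution class of weak passive-vector / linearised Navier–Stokes solutions on `T^d`

Analysis/FluidPDE proof-support file (everything proved; no new definitions). The class API of
the weak notion `Torus.IsWeakPassiveVectorOn A T ν b w₀ w` of `PassiveVector.lean`
(`∂ₜw + (b·∇)w + A (w·∇)b + ∇π = νΔw`, `∇·w = 0`, tested against smooth divergence-free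
space–time fields; Yoshida–Kaneda 2000, eq. (4)–(5): `A = 0` passive solenoidal vector, `A = 1`
the Navier–Stokes equations linearised at the carrier `b`), for every `A`:

* joint measurability of `w` and `b` on `(0,T) × T^d` (`aestronglyMeasurable_uncurry`,
  `…_carrier`), the `L^∞_t L²_x` bound in `eLpNorm` form, `w(t) ∈ L²` for a.e. `t`,
  `w ∈ L¹_{t,x}`, `‖b‖‖w‖ ∈ L¹_{t,x}` (`integrable_norm_carrier_mul_norm`);
* integrability of the pairings `⟪w, Φ⟫`, `⟪w, (b·∇)Φ⟫ = ∑ⱼ bⱼ ⟪w, ∂ⱼΦ⟫`, `⟪b, (w·∇)Φ⟫` for jointly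
  continuous (resp. `C¹`-in-space with jointly continuous derivatives) fields `Φ`, hence of the
  weak integrand `⟪w, ∂ₜΨ + (b·∇)Ψ + νΔΨ⟫ + A⟪b, (w·∇)Ψ⟫` for a space–time test field `Ψ`
  (`integrable_weakIntegrand`), and the weak identity in product-measure form
  (`integral_prod_weak_eq`);
* **the weak formulation tested with `η(t) G(x)`** for a smooth compactly supported `η` with
  `tsupport η ⊆ (-∞,T)` and a smooth DIVERGENCE-FREE steady field `G` (`setIntegral_test_smul`):
  `∫_{(0,T)} (η' ∫⟪w, G⟫ + η (∫⟪w, (b·∇)G + νΔG⟫ + A ∫⟪b, (w·∇)G⟫)) + η(0) ∫⟪w₀, G⟫ = 0`, and its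
  a.e. du Bois-Reymond form (`ae_integral_inner_eq`): for a.e. `t ∈ (0,T)`,
  `∫⟪w(t), G⟫ = ∫⟪w₀, G⟫ + ∫_{(0,t]} (∫⟪w, (b·∇)G + νΔG⟫ + A ∫⟪b, (w·∇)G⟫) dτ`.

This is the vector twin of `PassiveScalarProofs` §SolutionClass / `PassiveScalarDiagForcedClass` /
`PassiveScalarSteadyTest`; it is the first brick of the weak existence (Galerkin identification) and
energy-equality (modewise identities) theory of the `A = 0` class asked for by route
`SolenoidalFractalHomogenisation` (support item `CascadeBookkeeping`, cell `ad-ideate`, LIT-PACK §38–§39).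

## Mathlib / tree search

Tree: `PassiveVector` (the notion), `TorusWeakFormBookkeeping` (`IsSpaceTimeTest.continuous_uncurry*`,
`inner_convect_eq_sum`), `TorusCalculusProofs.fderiv_apply_eq_sum_partialDeriv`,
`TorusTestFunction.fderiv_const_smul`, `TorusFourierConvolution.laplacian_const_smul_apply`,
`PassiveScalarFourier` (`timeDeriv_mul`), `DuBoisReymondAE`. `lean search 'IsWeakPassiveVectorOn\.'`:
no analytic lemma on the class exists (2026-08-27).

## References

* K. Yoshida, Y. Kaneda, Phys. Rev. E 63 (2000) 016308, §II eq. (4)–(5). [`YoshidaKaneda2000`]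
* R. J. DiPerna, P.-L. Lions, Invent. Math. 98 (1989), §II.1, (12)–(14) (weak transport classes). [`DiPernaLions1989`]
* R. Temam, *Navier–Stokes Equations* (3rd ed., 1984), Ch. III §1.1 (weak formulation with
  divergence-free tests). [`Temam1984`]
-/

noncomputable section

open MeasureTheory TopologicalSpace Set Function Filter Topology
open scoped ENNReal NNReal InnerProductSpace ContDiff

namespace Literature.Analysis.FluidPDE

namespace Torus

variable {d : Type*} [Fintype d] [DecidableEq d]

/-! ## Steady smooth fields scaled by a time profile -/

section SmulTest

omit [Fintype d] in
/-- `∂ᵢ (c f) = c ∂ᵢ f` for real functions on `T^d` (no differentiability needed). [folklore] -/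
private theorem partialDeriv_const_mul'' (c : ℝ) (f : UnitAddTorus d → ℝ) (i : d) (x : UnitAddTorus d) :
    FunctionSpaces.Torus.partialDeriv i (fun y => c * f y) x = c * FunctionSpaces.Torus.partialDeriv i f x := by
  simp only [FunctionSpaces.Torus.partialDeriv, FunctionSpaces.Torus.lineDeriv, deriv_const_mul_field']

/-- A constant multiple of a divergence-free field is divergence free (private twin of
`FunctionSpaces.Torus.IsDivFree.const_smul` of `OnsagerProofs`, not imported here). [folklore] -/
private theorem isDivFree_const_smul' {G : UnitAddTorus d → EuclideanSpace ℝ d}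
    (hG : FunctionSpaces.Torus.IsDivFree G) (c : ℝ) :
    FunctionSpaces.Torus.IsDivFree (c • G) := by
  intro x
  have h : ∀ i : d, FunctionSpaces.Torus.partialDeriv i (fun y => (c • G) y i) x =
      c * FunctionSpaces.Torus.partialDeriv i (fun y => G y i) x := by
    intro i
    have e : (fun y => (c • G) y i) = fun y => c * G y i := by
      funext y; simp [Pi.smul_apply, smul_eq_mul]
    rw [e, partialDeriv_const_mul'']
  unfold FunctionSpaces.Torus.divergence
  simp_rw [h]
  rw [← Finset.mul_sum]
  have h0 := hG x
  unfold FunctionSpaces.Torus.divergence at h0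
  rw [h0, mul_zero]

omit [DecidableEq d] in
/-- **Product test fields.** For a smooth compactly supported `η : ℝ → ℝ` with
`tsupport η ⊆ (-∞, T)` and a smooth field `G : T^d → F`, `Ψ(t, x) = η(t) • G(x)` is a space–time
test field on `T^d × [0, T)`. [cite: Temam1984, Ch. III §1.1] -/
theorem isSpaceTimeTest_smul_const {F : Type*} [NormedAddCommGroup F] [NormedSpace ℝ F]
    {T : ℝ} {η : ℝ → ℝ} (hη : ContDiff ℝ ∞ η)
    (hηc : HasCompactSupport η) (hηT : tsupport η ⊆ Iio T) {G : UnitAddTorus d → F}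
    (hG : FunctionSpaces.Torus.IsSmooth G) :
    FunctionSpaces.Torus.IsSpaceTimeTest T (fun t x => η t • G x) := by
  refine ⟨?_, ?_⟩
  · have h : FunctionSpaces.Torus.stLift (fun t x => η t • G x) =
        fun p : ℝ × EuclideanSpace ℝ d => η p.1 • FunctionSpaces.Torus.lift G p.2 := by
      funext p; simp [FunctionSpaces.Torus.stLift, FunctionSpaces.Torus.lift]
    rw [h]
    exact (hη.comp contDiff_fst).smul ((hG : ContDiff ℝ ∞ (FunctionSpaces.Torus.lift G)).comp contDiff_snd)
  · obtain ⟨T', hT'T, hT'⟩ := FunctionSpaces.exists_lt_forall_eq_zero_of_tsupport_subset_Iio hηc hηT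
    exact ⟨T', hT'T, fun t ht => funext fun x => by simp [hT' t ht]⟩

omit [Fintype d] [DecidableEq d] in
/-- Time derivative of a product test field: `∂ₜ(η • G) = η' • G` (`η` differentiable).
[cite: Temam1984, Ch. III §1.1] -/
theorem timeDeriv_smul_const {F : Type*} [NormedAddCommGroup F] [NormedSpace ℝ F]
    {η : ℝ → ℝ} (hη : Differentiable ℝ η) (G : UnitAddTorus d → F) (t : ℝ) (x : UnitAddTorus d) :
    FunctionSpaces.Torus.timeDeriv (fun t x => η t • G x) t x = deriv η t • G x := by
  simp only [FunctionSpaces.Torus.timeDeriv]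
  exact deriv_smul_const (hη t) (G x)

omit [DecidableEq d] in
/-- Convective derivative of a product test field: `(u·∇)(η(t) • G) = η(t) • (u·∇)G` (private twin of
`Torus.convect_smul_const` of `NovackScalingLawsBridge`, not imported here). [folklore] -/
private theorem convect_smul_const' {F : Type*} [NormedAddCommGroup F] [NormedSpace ℝ F]
    {η : ℝ → ℝ} {G : UnitAddTorus d → F} (hG : FunctionSpaces.Torus.IsContDiff 1 G)
    (u : UnitAddTorus d → EuclideanSpace ℝ d) (t : ℝ) (x : UnitAddTorus d) :
    FunctionSpaces.Torus.convect u ((fun t x => η t • G x) t) x = η t • FunctionSpaces.Torus.convect u G x := by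
  simp only [FunctionSpaces.Torus.convect]
  rw [show (fun x => η t • G x) = η t • G from rfl, FunctionSpaces.Torus.fderiv_const_smul hG]
  rfl

omit [DecidableEq d] in
/-- Laplacian of a product test field: `Δ(η(t) • G) = η(t) • ΔG`. [cite: Temam1984, Ch. III §1.1] -/
theorem laplacian_smul_const {F : Type*} [NormedAddCommGroup F] [NormedSpace ℝ F]
    {η : ℝ → ℝ} {G : UnitAddTorus d → F} (hG : FunctionSpaces.Torus.IsSmooth G) (t : ℝ) (x : UnitAddTorus d) :
    FunctionSpaces.Torus.laplacian ((fun t x => η t • G x) t) x = η t • FunctionSpaces.Torus.laplacian G x := by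
  rw [show ((fun t x => η t • G x) t) = η t • G from rfl]
  exact FunctionSpaces.Torus.laplacian_const_smul_apply hG (η t) x

end SmulTest

/-! ## The solution class -/

namespace IsWeakPassiveVectorOn

variable {A T ν : ℝ} {b w : ℝ → UnitAddTorus d → EuclideanSpace ℝ d} {w₀ : UnitAddTorus d → EuclideanSpace ℝ d}
  {Ψ : ℝ → UnitAddTorus d → EuclideanSpace ℝ d}

/-- Joint measurability of `w` on `(0,T) × T^d`. [cite: DiPernaLions1989, §II.1 (12)–(14)] -/
theorem aestronglyMeasurable_uncurry (h : IsWeakPassiveVectorOn A T ν b w₀ w) :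
    AEStronglyMeasurable (uncurry w) (((volume : Measure ℝ).restrict (Ioo 0 T)).prod volume) := by
  rw [← volume_restrict_prod_eq]
  exact FunctionSpaces.Torus.aestronglyMeasurable_uncurry_of_stLift_restrict h.aestronglyMeasurable

/-- Joint measurability of the carrier `b` on `(0,T) × T^d`. [cite: DiPernaLions1989, §II.1 (12)–(14)] -/
theorem aestronglyMeasurable_uncurry_carrier (h : IsWeakPassiveVectorOn A T ν b w₀ w) :
    AEStronglyMeasurable (uncurry b) (((volume : Measure ℝ).restrict (Ioo 0 T)).prod volume) := by
  rw [← volume_restrict_prod_eq]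
  exact FunctionSpaces.Torus.aestronglyMeasurable_uncurry_of_stLift_restrict h.aestronglyMeasurable_carrier

/-- Slices are measurable for a.e. `t`: `w t`, `b t` a.e. strongly measurable on `T^d`.
[cite: DiPernaLions1989, §II.1 (12)–(14)] -/
theorem ae_aestronglyMeasurable_slice (h : IsWeakPassiveVectorOn A T ν b w₀ w) :
    ∀ᵐ t ∂(volume.restrict (Ioo 0 T)),
      AEStronglyMeasurable (w t) volume ∧ AEStronglyMeasurable (b t) volume := by
  filter_upwards [h.aestronglyMeasurable_uncurry.prodMk_left,
    h.aestronglyMeasurable_uncurry_carrier.prodMk_left] with t h1 h2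
  exact ⟨h1, h2⟩

/-- The `L^∞_t L²_x` bound in `eLpNorm` form. [cite: DiPernaLions1989, §II.1 (12)–(14)] -/
theorem exists_eLpNorm_le (h : IsWeakPassiveVectorOn A T ν b w₀ w) :
    ∃ C : ℝ≥0, ∀ᵐ t ∂(volume.restrict (Ioo 0 T)), eLpNorm (w t) 2 volume ≤ C := by
  obtain ⟨C, hC⟩ := h.ae_lintegral_sq_le
  refine ⟨NNReal.sqrt C, ?_⟩
  filter_upwards [hC] with t ht
  rw [eLpNorm_eq_lintegral_rpow_enorm_toReal two_ne_zero ENNReal.ofNat_ne_top, ENNReal.toReal_ofNat]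
  have h2 : ∫⁻ x, ‖w t x‖ₑ ^ (2 : ℝ) = ∫⁻ x, ‖w t x‖ₑ ^ 2 := by
    refine lintegral_congr fun x => ?_
    rw [← ENNReal.rpow_two]
  rw [h2]
  calc (∫⁻ x, ‖w t x‖ₑ ^ 2) ^ (1 / (2 : ℝ)) ≤ (C : ℝ≥0∞) ^ (1 / (2 : ℝ)) := by gcongr
    _ = NNReal.sqrt C := by
        rw [← ENNReal.coe_rpow_of_nonneg _ (by norm_num), ← NNReal.sqrt_eq_rpow]

/-- For a.e. `t ∈ (0,T)`, `w t ∈ L²(T^d)`. [cite: DiPernaLions1989, §II.1 (12)–(14)] -/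
theorem ae_memLp_two (h : IsWeakPassiveVectorOn A T ν b w₀ w) :
    ∀ᵐ t ∂(volume.restrict (Ioo 0 T)), MemLp (w t) 2 volume := by
  obtain ⟨C, hC⟩ := h.exists_eLpNorm_le
  filter_upwards [hC, h.aestronglyMeasurable_uncurry.prodMk_left] with t ht hm
  exact ⟨hm, ht.trans_lt ENNReal.coe_lt_top⟩

/-- `w ∈ L¹((0,T) × T^d)`. [cite: DiPernaLions1989, §II.1 (12)–(14)] -/
theorem integrable_uncurry (h : IsWeakPassiveVectorOn A T ν b w₀ w) :
    Integrable (uncurry w) (((volume : Measure ℝ).restrict (Ioo 0 T)).prod volume) := by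
  obtain ⟨C, hC⟩ := h.exists_eLpNorm_le
  refine ⟨h.aestronglyMeasurable_uncurry, ?_⟩
  rw [hasFiniteIntegral_iff_enorm, lintegral_prod _ h.aestronglyMeasurable_uncurry.enorm]
  calc ∫⁻ t in Ioo 0 T, ∫⁻ x, ‖uncurry w (t, x)‖ₑ
      ≤ ∫⁻ _ in Ioo 0 T, (C : ℝ≥0∞) := by
        refine lintegral_mono_ae ?_
        filter_upwards [hC, h.aestronglyMeasurable_uncurry.prodMk_left] with t ht hm
        calc ∫⁻ x, ‖uncurry w (t, x)‖ₑ = eLpNorm (w t) 1 volume := by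
              rw [eLpNorm_one_eq_lintegral_enorm]; rfl
          _ ≤ eLpNorm (w t) 2 volume := eLpNorm_le_eLpNorm_of_exponent_le (by norm_num) hm
          _ ≤ C := ht
    _ < ⊤ := by
        rw [setLIntegral_const]
        exact ENNReal.mul_lt_top ENNReal.coe_lt_top measure_Ioo_lt_top

/-- `‖b‖ ‖w‖ ∈ L¹((0,T) × T^d)`. [cite: DiPernaLions1989, §II.1 (12)–(14)] -/
theorem integrable_norm_carrier_mul_norm (h : IsWeakPassiveVectorOn A T ν b w₀ w) :
    Integrable (fun p : ℝ × UnitAddTorus d => ‖b p.1 p.2‖ * ‖w p.1 p.2‖)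
      (((volume : Measure ℝ).restrict (Ioo 0 T)).prod volume) := by
  have hm : AEStronglyMeasurable (fun p : ℝ × UnitAddTorus d => ‖b p.1 p.2‖ * ‖w p.1 p.2‖)
      (((volume : Measure ℝ).restrict (Ioo 0 T)).prod volume) :=
    h.aestronglyMeasurable_uncurry_carrier.norm.mul h.aestronglyMeasurable_uncurry.norm
  refine ⟨hm, ?_⟩
  rw [hasFiniteIntegral_iff_enorm, lintegral_prod _ hm.enorm]
  have h' := h.lintegral_mul_lt_top
  simp only [enorm_mul, enorm_norm] at h' ⊢
  exact h'

omit [DecidableEq d] in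
/-- Points of `(0,T) × T^d` have their time coordinate in `(0,T)`, a.e. [folklore] -/
private theorem ae_fst_mem_Ioo' (T : ℝ) :
    ∀ᵐ p : ℝ × UnitAddTorus d ∂(((volume : Measure ℝ).restrict (Ioo 0 T)).prod volume),
      p.1 ∈ Ioo 0 T :=
  (Measure.quasiMeasurePreserving_fst (μ := (volume : Measure ℝ).restrict (Ioo 0 T))
    (ν := (volume : Measure (UnitAddTorus d)))).ae (ae_restrict_mem measurableSet_Ioo)

/-! ## Integrability of the pairings -/

/-- Integrability on `(0,T) × T^d` of `⟪w, Φ⟫` for a jointly continuous field `Φ`.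
[cite: DiPernaLions1989, §II.1 (12)–(14)] -/
theorem integrable_inner_of_continuous (h : IsWeakPassiveVectorOn A T ν b w₀ w)
    {Φ : ℝ → UnitAddTorus d → EuclideanSpace ℝ d} (hΦ : Continuous (uncurry Φ)) :
    Integrable (fun p : ℝ × UnitAddTorus d => ⟪w p.1 p.2, Φ p.1 p.2⟫_ℝ)
      (((volume : Measure ℝ).restrict (Ioo 0 T)).prod volume) := by
  obtain ⟨C₀, hC₀⟩ := exists_bound_of_continuous_uncurry hΦ 0 T
  refine Integrable.mono' (g := fun p : ℝ × UnitAddTorus d => ‖uncurry w p‖ * C₀)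
    (h.integrable_uncurry.norm.mul_const C₀)
    (h.aestronglyMeasurable_uncurry.inner hΦ.aestronglyMeasurable) ?_
  filter_upwards [ae_fst_mem_Ioo' (d := d) T] with p hp
  exact (norm_inner_le_norm _ _).trans (mul_le_mul_of_nonneg_left (hC₀ p.1 (Ioo_subset_Icc_self hp) p.2) (norm_nonneg _))

/-- Integrability on `(0,T) × T^d` of `bⱼ ⟪w, Φ⟫` for a jointly continuous field `Φ` (the summands
of the transport pairing `⟪w, (b·∇)Ψ⟫ = ∑ⱼ bⱼ ⟪w, ∂ⱼΨ⟫`; `‖b‖‖w‖ ∈ L¹`). [cite: DiPernaLions1989, §II.1 (12)–(14)] -/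
theorem integrable_carrier_mul_inner_of_continuous (h : IsWeakPassiveVectorOn A T ν b w₀ w)
    {Φ : ℝ → UnitAddTorus d → EuclideanSpace ℝ d} (hΦ : Continuous (uncurry Φ)) (j : d) :
    Integrable (fun p : ℝ × UnitAddTorus d => b p.1 p.2 j * ⟪w p.1 p.2, Φ p.1 p.2⟫_ℝ)
      (((volume : Measure ℝ).restrict (Ioo 0 T)).prod volume) := by
  obtain ⟨C₀, hC₀⟩ := exists_bound_of_continuous_uncurry hΦ 0 T
  have hm : AEStronglyMeasurable (fun p : ℝ × UnitAddTorus d => b p.1 p.2 j * ⟪w p.1 p.2, Φ p.1 p.2⟫_ℝ)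
      (((volume : Measure ℝ).restrict (Ioo 0 T)).prod volume) :=
    ((EuclideanSpace.proj j).continuous.comp_aestronglyMeasurable h.aestronglyMeasurable_uncurry_carrier).mul
      (h.aestronglyMeasurable_uncurry.inner hΦ.aestronglyMeasurable)
  refine Integrable.mono' (g := fun p : ℝ × UnitAddTorus d => ‖b p.1 p.2‖ * ‖w p.1 p.2‖ * C₀)
    (h.integrable_norm_carrier_mul_norm.mul_const C₀) hm ?_
  filter_upwards [ae_fst_mem_Ioo' (d := d) T] with p hp
  rw [norm_mul]
  calc ‖b p.1 p.2 j‖ * ‖⟪w p.1 p.2, Φ p.1 p.2⟫_ℝ‖ ≤ ‖b p.1 p.2‖ * (‖w p.1 p.2‖ * C₀) :=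
        mul_le_mul (by simpa [Real.norm_eq_abs] using FunctionSpaces.Torus.abs_apply_le_norm (b p.1 p.2) j)
          ((norm_inner_le_norm _ _).trans (mul_le_mul_of_nonneg_left (hC₀ p.1 (Ioo_subset_Icc_self hp) p.2)
            (norm_nonneg _))) (norm_nonneg _) (norm_nonneg _)
    _ = ‖b p.1 p.2‖ * ‖w p.1 p.2‖ * C₀ := by ring

/-- Integrability on `(0,T) × T^d` of `wⱼ ⟪b, Φ⟫` for a jointly continuous field `Φ` (the summands
of the stretching pairing `⟪b, (w·∇)Ψ⟫ = ∑ⱼ wⱼ ⟪b, ∂ⱼΨ⟫`). [cite: DiPernaLions1989, §II.1 (12)–(14)] -/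
theorem integrable_mul_inner_carrier_of_continuous (h : IsWeakPassiveVectorOn A T ν b w₀ w)
    {Φ : ℝ → UnitAddTorus d → EuclideanSpace ℝ d} (hΦ : Continuous (uncurry Φ)) (j : d) :
    Integrable (fun p : ℝ × UnitAddTorus d => w p.1 p.2 j * ⟪b p.1 p.2, Φ p.1 p.2⟫_ℝ)
      (((volume : Measure ℝ).restrict (Ioo 0 T)).prod volume) := by
  obtain ⟨C₀, hC₀⟩ := exists_bound_of_continuous_uncurry hΦ 0 T
  have hm : AEStronglyMeasurable (fun p : ℝ × UnitAddTorus d => w p.1 p.2 j * ⟪b p.1 p.2, Φ p.1 p.2⟫_ℝ)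
      (((volume : Measure ℝ).restrict (Ioo 0 T)).prod volume) :=
    ((EuclideanSpace.proj j).continuous.comp_aestronglyMeasurable h.aestronglyMeasurable_uncurry).mul
      (h.aestronglyMeasurable_uncurry_carrier.inner hΦ.aestronglyMeasurable)
  refine Integrable.mono' (g := fun p : ℝ × UnitAddTorus d => ‖b p.1 p.2‖ * ‖w p.1 p.2‖ * C₀)
    (h.integrable_norm_carrier_mul_norm.mul_const C₀) hm ?_
  filter_upwards [ae_fst_mem_Ioo' (d := d) T] with p hp
  rw [norm_mul]
  calc ‖w p.1 p.2 j‖ * ‖⟪b p.1 p.2, Φ p.1 p.2⟫_ℝ‖ ≤ ‖w p.1 p.2‖ * (‖b p.1 p.2‖ * C₀) :=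
        mul_le_mul (by simpa [Real.norm_eq_abs] using FunctionSpaces.Torus.abs_apply_le_norm (w p.1 p.2) j)
          ((norm_inner_le_norm _ _).trans (mul_le_mul_of_nonneg_left (hC₀ p.1 (Ioo_subset_Icc_self hp) p.2)
            (norm_nonneg _))) (norm_nonneg _) (norm_nonneg _)
    _ = ‖b p.1 p.2‖ * ‖w p.1 p.2‖ * C₀ := by ring

/-- The transport pairing expanded: `⟪w, (b·∇)Φ⟫ = ∑ⱼ bⱼ ⟪w, ∂ⱼΦ⟫` for a `C¹` slice `Φ`.
[cite: Temam1984, Ch. III §1.1] -/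
theorem inner_convect_eq_sum' {Φ : UnitAddTorus d → EuclideanSpace ℝ d} (hΦ : FunctionSpaces.Torus.IsContDiff 1 Φ)
    (v u : EuclideanSpace ℝ d) (x : UnitAddTorus d) :
    ⟪v, FunctionSpaces.Torus.fderiv Φ x u⟫_ℝ = ∑ j, u j * ⟪v, FunctionSpaces.Torus.partialDeriv j Φ x⟫_ℝ := by
  rw [FunctionSpaces.Torus.fderiv_apply_eq_sum_partialDeriv hΦ, inner_sum]
  refine Finset.sum_congr rfl fun j _ => ?_
  rw [real_inner_smul_right]

/-- Integrability on `(0,T) × T^d` of the transport pairing `⟪w, (b(t)·∇)Φ(t)⟫` for a field `Φ`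
smooth in space with jointly continuous partial derivatives (e.g. a space–time test field or
`η(t) • G`). [cite: DiPernaLions1989, §II.1 (12)–(14)] -/
theorem integrable_inner_convect (h : IsWeakPassiveVectorOn A T ν b w₀ w)
    {Φ : ℝ → UnitAddTorus d → EuclideanSpace ℝ d} (hΦ1 : ∀ t, FunctionSpaces.Torus.IsContDiff 1 (Φ t))
    (hΦd : ∀ j, Continuous (uncurry fun t x => FunctionSpaces.Torus.partialDeriv j (Φ t) x)) :
    Integrable (fun p : ℝ × UnitAddTorus d => ⟪w p.1 p.2, FunctionSpaces.Torus.convect (b p.1) (Φ p.1) p.2⟫_ℝ)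
      (((volume : Measure ℝ).restrict (Ioo 0 T)).prod volume) := by
  have e : (fun p : ℝ × UnitAddTorus d => ⟪w p.1 p.2, FunctionSpaces.Torus.convect (b p.1) (Φ p.1) p.2⟫_ℝ) =
      fun p => ∑ j, b p.1 p.2 j * ⟪w p.1 p.2, FunctionSpaces.Torus.partialDeriv j (Φ p.1) p.2⟫_ℝ := by
    funext p
    exact inner_convect_eq_sum' (hΦ1 p.1) _ _ _
  rw [e]
  exact integrable_finsetSum _ fun j _ => h.integrable_carrier_mul_inner_of_continuous (hΦd j) j

/-- Integrability on `(0,T) × T^d` of the stretching pairing `⟪b, (w(t)·∇)Φ(t)⟫` under the same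
hypotheses. [cite: DiPernaLions1989, §II.1 (12)–(14)] -/
theorem integrable_inner_carrier_convect (h : IsWeakPassiveVectorOn A T ν b w₀ w)
    {Φ : ℝ → UnitAddTorus d → EuclideanSpace ℝ d} (hΦ1 : ∀ t, FunctionSpaces.Torus.IsContDiff 1 (Φ t))
    (hΦd : ∀ j, Continuous (uncurry fun t x => FunctionSpaces.Torus.partialDeriv j (Φ t) x)) :
    Integrable (fun p : ℝ × UnitAddTorus d => ⟪b p.1 p.2, FunctionSpaces.Torus.convect (w p.1) (Φ p.1) p.2⟫_ℝ)
      (((volume : Measure ℝ).restrict (Ioo 0 T)).prod volume) := by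
  have e : (fun p : ℝ × UnitAddTorus d => ⟪b p.1 p.2, FunctionSpaces.Torus.convect (w p.1) (Φ p.1) p.2⟫_ℝ) =
      fun p => ∑ j, w p.1 p.2 j * ⟪b p.1 p.2, FunctionSpaces.Torus.partialDeriv j (Φ p.1) p.2⟫_ℝ := by
    funext p
    exact inner_convect_eq_sum' (hΦ1 p.1) _ _ _
  rw [e]
  exact integrable_finsetSum _ fun j _ => h.integrable_mul_inner_carrier_of_continuous (hΦd j) j

/-! ## The weak identity in product-measure form -/

/-- Partial derivatives `(t, x) ↦ ∂ⱼ(Ψ t)(x)` of a space–time test field are jointly continuous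
(private twin of `IsSpaceTimeTest.continuous_uncurry_partialDeriv` of
`Barriers/…/ShearFlowViscositySelectionTransport`, not imported here). [folklore] -/
private theorem continuous_uncurry_partialDeriv' {F : Type*} [NormedAddCommGroup F] [NormedSpace ℝ F]
    {T : ℝ} {ψ : ℝ → UnitAddTorus d → F} (hψ : FunctionSpaces.Torus.IsSpaceTimeTest T ψ) (j : d) :
    Continuous (uncurry fun t x => FunctionSpaces.Torus.partialDeriv j (ψ t) x) :=
  hψ.continuous_uncurry_lineDeriv (EuclideanSpace.single j 1)

/-- **Integrability of the weak integrand** `⟪w, ∂ₜΨ + (b·∇)Ψ + νΔΨ⟫ + A ⟪b, (w·∇)Ψ⟫` on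
`(0,T) × T^d` for a weak solution and a (vector) space–time test field `Ψ`.
[cite: DiPernaLions1989, §II.1 (12)–(14)] -/
theorem integrable_weakIntegrand (h : IsWeakPassiveVectorOn A T ν b w₀ w)
    (hΨ : FunctionSpaces.Torus.IsSpaceTimeTest T Ψ) :
    Integrable (fun p : ℝ × UnitAddTorus d =>
      ⟪w p.1 p.2, FunctionSpaces.Torus.timeDeriv Ψ p.1 p.2 +
          FunctionSpaces.Torus.convect (b p.1) (Ψ p.1) p.2 + ν • FunctionSpaces.Torus.laplacian (Ψ p.1) p.2⟫_ℝ +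
        A * ⟪b p.1 p.2, FunctionSpaces.Torus.convect (w p.1) (Ψ p.1) p.2⟫_ℝ)
      (((volume : Measure ℝ).restrict (Ioo 0 T)).prod volume) := by
  have hΨ1 : ∀ t, FunctionSpaces.Torus.IsContDiff 1 (Ψ t) := fun t => (hΨ.isSmooth_slice t).isContDiff (by simp)
  have hΨd : ∀ j, Continuous (uncurry fun t x => FunctionSpaces.Torus.partialDeriv j (Ψ t) x) :=
    fun j => continuous_uncurry_partialDeriv' hΨ j
  have e : (fun p : ℝ × UnitAddTorus d =>
      ⟪w p.1 p.2, FunctionSpaces.Torus.timeDeriv Ψ p.1 p.2 +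
          FunctionSpaces.Torus.convect (b p.1) (Ψ p.1) p.2 + ν • FunctionSpaces.Torus.laplacian (Ψ p.1) p.2⟫_ℝ +
        A * ⟪b p.1 p.2, FunctionSpaces.Torus.convect (w p.1) (Ψ p.1) p.2⟫_ℝ) =
      fun p => (⟪w p.1 p.2, FunctionSpaces.Torus.timeDeriv Ψ p.1 p.2⟫_ℝ +
        ⟪w p.1 p.2, FunctionSpaces.Torus.convect (b p.1) (Ψ p.1) p.2⟫_ℝ +
        ν * ⟪w p.1 p.2, FunctionSpaces.Torus.laplacian (Ψ p.1) p.2⟫_ℝ) +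
        A * ⟪b p.1 p.2, FunctionSpaces.Torus.convect (w p.1) (Ψ p.1) p.2⟫_ℝ := by
    funext p
    rw [inner_add_right, inner_add_right, real_inner_smul_right]
  rw [e]
  refine (((h.integrable_inner_of_continuous hΨ.continuous_uncurry_timeDeriv).add
    (h.integrable_inner_convect hΨ1 hΨd)).add
    ((h.integrable_inner_of_continuous hΨ.continuous_uncurry_laplacian).const_mul ν)).add
    ((h.integrable_inner_carrier_convect hΨ1 hΨd).const_mul A)

/-- The weak identity in product-measure form:
`∫_{(0,T)×T^d} (⟪w, ∂ₜΨ + (b·∇)Ψ + νΔΨ⟫ + A ⟪b, (w·∇)Ψ⟫) + ∫ ⟪w₀, Ψ(0)⟫ = 0`.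
[cite: YoshidaKaneda2000, §II eq. (4)-(5)] -/
theorem integral_prod_weak_eq (h : IsWeakPassiveVectorOn A T ν b w₀ w)
    (hΨ : FunctionSpaces.Torus.IsSpaceTimeTest T Ψ) (hΨdiv : ∀ t, FunctionSpaces.Torus.IsDivFree (Ψ t)) :
    (∫ p : ℝ × UnitAddTorus d,
      (⟪w p.1 p.2, FunctionSpaces.Torus.timeDeriv Ψ p.1 p.2 +
          FunctionSpaces.Torus.convect (b p.1) (Ψ p.1) p.2 + ν • FunctionSpaces.Torus.laplacian (Ψ p.1) p.2⟫_ℝ +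
        A * ⟪b p.1 p.2, FunctionSpaces.Torus.convect (w p.1) (Ψ p.1) p.2⟫_ℝ)
      ∂(((volume : Measure ℝ).restrict (Ioo 0 T)).prod volume)) +
      ∫ x, ⟪w₀ x, Ψ 0 x⟫_ℝ = 0 := by
  rw [integral_prod _ (h.integrable_weakIntegrand hΨ)]
  exact h.weak_eq Ψ hΨ hΨdiv

/-! ## Testing with `η(t) • G(x)`, `G` smooth and divergence free -/

/-- **The weak formulation tested with `η(t) • G(x)`.** For a smooth compactly supported `η`
with `tsupport η ⊆ (-∞, T)` and a smooth divergence-free field `G : T^d → ℝ^d`,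
`∫_{(0,T)} (η'(t) ∫⟪w(t), G⟫ + η(t) (∫⟪w(t), (b(t)·∇)G + νΔG⟫ + A ∫⟪b(t), (w(t)·∇)G⟫)) dt + η(0) ∫⟪w₀, G⟫ = 0`
(separation of the time and space test functions, Temam 1984, Ch. III §1.1 / (1.11)).
[cite: Temam1984, Ch. III §1.1] -/
theorem setIntegral_test_smul (h : IsWeakPassiveVectorOn A T ν b w₀ w) {η : ℝ → ℝ}
    (hη : ContDiff ℝ ∞ η) (hηc : HasCompactSupport η) (hηT : tsupport η ⊆ Iio T)
    {G : UnitAddTorus d → EuclideanSpace ℝ d} (hG : FunctionSpaces.Torus.IsSmooth G)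
    (hGdiv : FunctionSpaces.Torus.IsDivFree G) :
    (∫ t in Ioo 0 T, ((deriv η t * ∫ x, ⟪w t x, G x⟫_ℝ) +
      η t * ((∫ x, ⟪w t x, FunctionSpaces.Torus.convect (b t) G x + ν • FunctionSpaces.Torus.laplacian G x⟫_ℝ) +
        A * ∫ x, ⟪b t x, FunctionSpaces.Torus.convect (w t) G x⟫_ℝ))) +
      η 0 * ∫ x, ⟪w₀ x, G x⟫_ℝ = 0 := by
  have hΨ := isSpaceTimeTest_smul_const hη hηc hηT hG
  have hG1 : FunctionSpaces.Torus.IsContDiff 1 G := hG.isContDiff (by simp)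
  have hΨdiv : ∀ t, FunctionSpaces.Torus.IsDivFree ((fun t x => η t • G x) t) := fun t => by
    rw [show ((fun t x => η t • G x) t) = η t • G from rfl]
    exact isDivFree_const_smul' hGdiv (η t)
  have key := h.integral_prod_weak_eq hΨ hΨdiv
  set P : Measure (ℝ × UnitAddTorus d) := ((volume : Measure ℝ).restrict (Ioo 0 T)).prod volume with hP
  -- pointwise form of the integrand
  have hpt : ∀ p : ℝ × UnitAddTorus d,
      ⟪w p.1 p.2, FunctionSpaces.Torus.timeDeriv (fun t x => η t • G x) p.1 p.2 +
          FunctionSpaces.Torus.convect (b p.1) ((fun t x => η t • G x) p.1) p.2 +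
          ν • FunctionSpaces.Torus.laplacian ((fun t x => η t • G x) p.1) p.2⟫_ℝ +
        A * ⟪b p.1 p.2, FunctionSpaces.Torus.convect (w p.1) ((fun t x => η t • G x) p.1) p.2⟫_ℝ =
      deriv η p.1 * ⟪w p.1 p.2, G p.2⟫_ℝ +
        η p.1 * (⟪w p.1 p.2, FunctionSpaces.Torus.convect (b p.1) G p.2 + ν • FunctionSpaces.Torus.laplacian G p.2⟫_ℝ +
          A * ⟪b p.1 p.2, FunctionSpaces.Torus.convect (w p.1) G p.2⟫_ℝ) := by
    intro p
    rw [timeDeriv_smul_const (hη.differentiable (by simp)), convect_smul_const' hG1, convect_smul_const' hG1,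
      laplacian_smul_const hG]
    simp only [inner_add_right, real_inner_smul_right]
    ring
  have hpt' : ∀ p : ℝ × UnitAddTorus d,
      deriv η p.1 * ⟪w p.1 p.2, G p.2⟫_ℝ +
        η p.1 * ⟪w p.1 p.2, FunctionSpaces.Torus.convect (b p.1) G p.2 + ν • FunctionSpaces.Torus.laplacian G p.2⟫_ℝ +
        η p.1 * (A * ⟪b p.1 p.2, FunctionSpaces.Torus.convect (w p.1) G p.2⟫_ℝ) =
      ⟪w p.1 p.2, FunctionSpaces.Torus.timeDeriv (fun t x => η t • G x) p.1 p.2 +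
          FunctionSpaces.Torus.convect (b p.1) ((fun t x => η t • G x) p.1) p.2 +
          ν • FunctionSpaces.Torus.laplacian ((fun t x => η t • G x) p.1) p.2⟫_ℝ +
        A * ⟪b p.1 p.2, FunctionSpaces.Torus.convect (w p.1) ((fun t x => η t • G x) p.1) p.2⟫_ℝ := by
    intro p
    rw [hpt p]
    ring
  obtain ⟨Ca, hCa⟩ := (hη.continuous_deriv (by simp)).bounded_above_of_compact_support hηc.deriv
  obtain ⟨Cb, hCb⟩ := hη.continuous.bounded_above_of_compact_support hηc
  set f₁ : ℝ × UnitAddTorus d → ℝ := fun p => deriv η p.1 * ⟪w p.1 p.2, G p.2⟫_ℝ with hf₁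
  set f₂ : ℝ × UnitAddTorus d → ℝ := fun p =>
    η p.1 * ⟪w p.1 p.2, FunctionSpaces.Torus.convect (b p.1) G p.2 + ν • FunctionSpaces.Torus.laplacian G p.2⟫_ℝ with hf₂
  set f₃ : ℝ × UnitAddTorus d → ℝ := fun p => η p.1 * (A * ⟪b p.1 p.2, FunctionSpaces.Torus.convect (w p.1) G p.2⟫_ℝ)
    with hf₃
  -- integrability of the three pieces
  have hGc : Continuous (uncurry fun (_ : ℝ) (x : UnitAddTorus d) => G x) := hG.continuous.comp continuous_snd
  have hGd : ∀ j, Continuous (uncurry fun (_ : ℝ) (x : UnitAddTorus d) => FunctionSpaces.Torus.partialDeriv j G x) :=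
    fun j => (hG.partialDeriv j).continuous.comp continuous_snd
  have hGl : Continuous (uncurry fun (_ : ℝ) (x : UnitAddTorus d) => FunctionSpaces.Torus.laplacian G x) :=
    hG.laplacian.continuous.comp continuous_snd
  have hI₁ : Integrable (fun p : ℝ × UnitAddTorus d => ⟪w p.1 p.2, G p.2⟫_ℝ) P :=
    h.integrable_inner_of_continuous hGc
  have hI₂ : Integrable (fun p : ℝ × UnitAddTorus d =>
      ⟪w p.1 p.2, FunctionSpaces.Torus.convect (b p.1) G p.2 + ν • FunctionSpaces.Torus.laplacian G p.2⟫_ℝ) P := by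
    have e : (fun p : ℝ × UnitAddTorus d =>
        ⟪w p.1 p.2, FunctionSpaces.Torus.convect (b p.1) G p.2 + ν • FunctionSpaces.Torus.laplacian G p.2⟫_ℝ) =
        fun p => ⟪w p.1 p.2, FunctionSpaces.Torus.convect (b p.1) ((fun (_ : ℝ) x => G x) p.1) p.2⟫_ℝ +
          ν * ⟪w p.1 p.2, (fun (_ : ℝ) x => FunctionSpaces.Torus.laplacian G x) p.1 p.2⟫_ℝ := by
      funext p
      rw [inner_add_right, real_inner_smul_right]
    rw [e]
    exact (h.integrable_inner_convect (fun _ => hG1) hGd).add ((h.integrable_inner_of_continuous hGl).const_mul ν)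
  have hI₃ : Integrable (fun p : ℝ × UnitAddTorus d => A * ⟪b p.1 p.2, FunctionSpaces.Torus.convect (w p.1) G p.2⟫_ℝ) P :=
    (h.integrable_inner_carrier_convect (Φ := fun _ => G) (fun _ => hG1) hGd).const_mul A
  have hf₁i : Integrable f₁ P :=
    hI₁.bdd_mul ((hη.continuous_deriv (by simp)).comp continuous_fst).aestronglyMeasurable
      (Eventually.of_forall fun p => hCa p.1)
  have hf₂i : Integrable f₂ P :=
    hI₂.bdd_mul (hη.continuous.comp continuous_fst).aestronglyMeasurable
      (Eventually.of_forall fun p => hCb p.1)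
  have hf₃i : Integrable f₃ P :=
    hI₃.bdd_mul (hη.continuous.comp continuous_fst).aestronglyMeasurable
      (Eventually.of_forall fun p => hCb p.1)
  have esum : (∫ p, (f₁ p + f₂ p + f₃ p) ∂P) + η 0 * ∫ x, ⟪w₀ x, G x⟫_ℝ = 0 := by
    have e1 : ∫ p, (f₁ p + f₂ p + f₃ p) ∂P = ∫ p,
        (⟪w p.1 p.2, FunctionSpaces.Torus.timeDeriv (fun t x => η t • G x) p.1 p.2 +
            FunctionSpaces.Torus.convect (b p.1) ((fun t x => η t • G x) p.1) p.2 +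
            ν • FunctionSpaces.Torus.laplacian ((fun t x => η t • G x) p.1) p.2⟫_ℝ +
          A * ⟪b p.1 p.2, FunctionSpaces.Torus.convect (w p.1) ((fun t x => η t • G x) p.1) p.2⟫_ℝ) ∂P :=
      integral_congr_ae (Eventually.of_forall fun p => hpt' p)
    have e2 : η 0 * ∫ x, ⟪w₀ x, G x⟫_ℝ = ∫ x, ⟪w₀ x, (fun t x => η t • G x) 0 x⟫_ℝ := by
      rw [← integral_const_mul]
      refine integral_congr_ae (Eventually.of_forall fun x => ?_)
      simp only [real_inner_smul_right]
    rw [e1, e2]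
    exact key
  have e₁ : ∫ p, f₁ p ∂P = ∫ t in Ioo 0 T, deriv η t * ∫ x, ⟪w t x, G x⟫_ℝ := by
    rw [hP, integral_prod _ hf₁i]
    refine integral_congr_ae (Eventually.of_forall fun t => ?_)
    simp only [hf₁]
    exact integral_const_mul _ _
  have e₂ : ∫ p, f₂ p ∂P = ∫ t in Ioo 0 T, η t * ∫ x,
      ⟪w t x, FunctionSpaces.Torus.convect (b t) G x + ν • FunctionSpaces.Torus.laplacian G x⟫_ℝ := by
    rw [hP, integral_prod _ hf₂i]
    refine integral_congr_ae (Eventually.of_forall fun t => ?_)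
    simp only [hf₂]
    exact integral_const_mul _ _
  have e₃ : ∫ p, f₃ p ∂P = ∫ t in Ioo 0 T, η t * (A * ∫ x, ⟪b t x, FunctionSpaces.Torus.convect (w t) G x⟫_ℝ) := by
    rw [hP, integral_prod _ hf₃i]
    refine integral_congr_ae (Eventually.of_forall fun t => ?_)
    simp only [hf₃]
    rw [integral_const_mul, integral_const_mul]
  have ha : Integrable (fun t => deriv η t * ∫ x, ⟪w t x, G x⟫_ℝ) (volume.restrict (Ioo 0 T)) := by
    refine hf₁i.integral_prod_left.congr (Eventually.of_forall fun t => ?_)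
    simp only [hf₁]
    exact integral_const_mul _ _
  have hb : Integrable (fun t => η t * ∫ x,
      ⟪w t x, FunctionSpaces.Torus.convect (b t) G x + ν • FunctionSpaces.Torus.laplacian G x⟫_ℝ)
      (volume.restrict (Ioo 0 T)) := by
    refine hf₂i.integral_prod_left.congr (Eventually.of_forall fun t => ?_)
    simp only [hf₂]
    exact integral_const_mul _ _
  have hc : Integrable (fun t => η t * (A * ∫ x, ⟪b t x, FunctionSpaces.Torus.convect (w t) G x⟫_ℝ))
      (volume.restrict (Ioo 0 T)) := by
    refine hf₃i.integral_prod_left.congr (Eventually.of_forall fun t => ?_)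
    simp only [hf₃]
    rw [integral_const_mul, integral_const_mul]
  have e12 : ∫ p, (f₁ p + f₂ p + f₃ p) ∂P = ((∫ p, f₁ p ∂P) + ∫ p, f₂ p ∂P) + ∫ p, f₃ p ∂P := by
    have h12 : Integrable (fun p => f₁ p + f₂ p) P := hf₁i.add hf₂i
    rw [integral_add h12 hf₃i, integral_add hf₁i hf₂i]
  rw [e12, e₁, e₂, e₃] at esum
  have esplit : ∀ t, (deriv η t * ∫ x, ⟪w t x, G x⟫_ℝ) +
      η t * ((∫ x, ⟪w t x, FunctionSpaces.Torus.convect (b t) G x + ν • FunctionSpaces.Torus.laplacian G x⟫_ℝ) +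
        A * ∫ x, ⟪b t x, FunctionSpaces.Torus.convect (w t) G x⟫_ℝ) =
      ((deriv η t * ∫ x, ⟪w t x, G x⟫_ℝ) +
        η t * ∫ x, ⟪w t x, FunctionSpaces.Torus.convect (b t) G x + ν • FunctionSpaces.Torus.laplacian G x⟫_ℝ) +
        η t * (A * ∫ x, ⟪b t x, FunctionSpaces.Torus.convect (w t) G x⟫_ℝ) := fun t => by ring
  have hab : Integrable (fun t => (deriv η t * ∫ x, ⟪w t x, G x⟫_ℝ) +
      η t * ∫ x, ⟪w t x, FunctionSpaces.Torus.convect (b t) G x + ν • FunctionSpaces.Torus.laplacian G x⟫_ℝ)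
      (volume.restrict (Ioo 0 T)) := ha.add hb
  simp_rw [esplit]
  rw [integral_add hab hc, integral_add ha hb]
  linarith

/-- **A weak passive-vector solution paired with a steady smooth divergence-free field is
absolutely continuous in time**: for a.e. `t ∈ (0,T)`,
`∫⟪w(t), G⟫ = ∫⟪w₀, G⟫ + ∫_{(0,t]} (∫⟪w(τ), (b(τ)·∇)G + νΔG⟫ + A ∫⟪b(τ), (w(τ)·∇)G⟫) dτ`
(`setIntegral_test_smul` and the a.e. du Bois-Reymond lemma with datum,
`FunctionSpaces.ae_eq_add_setIntegral_of_forall_test`). [cite: Temam1984, Ch. III §1.1] -/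
theorem ae_integral_inner_eq (h : IsWeakPassiveVectorOn A T ν b w₀ w)
    {G : UnitAddTorus d → EuclideanSpace ℝ d} (hG : FunctionSpaces.Torus.IsSmooth G)
    (hGdiv : FunctionSpaces.Torus.IsDivFree G) :
    ∀ᵐ t ∂(volume.restrict (Ioo 0 T)),
      ∫ x, ⟪w t x, G x⟫_ℝ = (∫ x, ⟪w₀ x, G x⟫_ℝ) +
        ∫ τ in Ioc 0 t, ((∫ x, ⟪w τ x, FunctionSpaces.Torus.convect (b τ) G x + ν • FunctionSpaces.Torus.laplacian G x⟫_ℝ) +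
          A * ∫ x, ⟪b τ x, FunctionSpaces.Torus.convect (w τ) G x⟫_ℝ) := by
  have hG1 : FunctionSpaces.Torus.IsContDiff 1 G := hG.isContDiff (by simp)
  have hGc : Continuous (uncurry fun (_ : ℝ) (x : UnitAddTorus d) => G x) := hG.continuous.comp continuous_snd
  have hGd : ∀ j, Continuous (uncurry fun (_ : ℝ) (x : UnitAddTorus d) => FunctionSpaces.Torus.partialDeriv j G x) :=
    fun j => (hG.partialDeriv j).continuous.comp continuous_snd
  have hGl : Continuous (uncurry fun (_ : ℝ) (x : UnitAddTorus d) => FunctionSpaces.Torus.laplacian G x) :=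
    hG.laplacian.continuous.comp continuous_snd
  have hU : IntegrableOn (fun t => ∫ x, ⟪w t x, G x⟫_ℝ) (Ioo 0 T) volume :=
    (h.integrable_inner_of_continuous hGc).integral_prod_left
  have hI₂ : Integrable (fun p : ℝ × UnitAddTorus d =>
      ⟪w p.1 p.2, FunctionSpaces.Torus.convect (b p.1) G p.2 + ν • FunctionSpaces.Torus.laplacian G p.2⟫_ℝ)
      (((volume : Measure ℝ).restrict (Ioo 0 T)).prod volume) := by
    have e : (fun p : ℝ × UnitAddTorus d =>
        ⟪w p.1 p.2, FunctionSpaces.Torus.convect (b p.1) G p.2 + ν • FunctionSpaces.Torus.laplacian G p.2⟫_ℝ) =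
        fun p => ⟪w p.1 p.2, FunctionSpaces.Torus.convect (b p.1) ((fun (_ : ℝ) x => G x) p.1) p.2⟫_ℝ +
          ν * ⟪w p.1 p.2, (fun (_ : ℝ) x => FunctionSpaces.Torus.laplacian G x) p.1 p.2⟫_ℝ := by
      funext p
      rw [inner_add_right, real_inner_smul_right]
    rw [e]
    exact (h.integrable_inner_convect (fun _ => hG1) hGd).add ((h.integrable_inner_of_continuous hGl).const_mul ν)
  have hI₃ : Integrable (fun p : ℝ × UnitAddTorus d => A * ⟪b p.1 p.2, FunctionSpaces.Torus.convect (w p.1) G p.2⟫_ℝ)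
      (((volume : Measure ℝ).restrict (Ioo 0 T)).prod volume) :=
    (h.integrable_inner_carrier_convect (Φ := fun _ => G) (fun _ => hG1) hGd).const_mul A
  have hF : IntegrableOn (fun t =>
      (∫ x, ⟪w t x, FunctionSpaces.Torus.convect (b t) G x + ν • FunctionSpaces.Torus.laplacian G x⟫_ℝ) +
        A * ∫ x, ⟪b t x, FunctionSpaces.Torus.convect (w t) G x⟫_ℝ) (Ioo 0 T) volume := by
    refine (hI₂.integral_prod_left.add hI₃.integral_prod_left).congr (Eventually.of_forall fun t => ?_)
    simp only [Pi.add_apply]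
    rw [integral_const_mul]
  exact FunctionSpaces.ae_eq_add_setIntegral_of_forall_test hU hF fun η hη hηc hηT =>
    h.setIntegral_test_smul hη hηc hηT hG hGdiv

end IsWeakPassiveVectorOn

end Torus

end Literature.Analysis.FluidPDE

end
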